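import Summits.QuantumFields.YangMills.Theorems.FluctuationComparisonRegPrIntLS1aCellMapLocalFace
import Summits.QuantumFields.YangMills.Theorems.FluctuationComparisonRegPrIntLS1aGuardSphereNull
import Literature.MathematicalPhysics.QuantumFieldTheory.Balaban1983to89.Node00.RegSetOfLocalFaces
import HarnessLib

/-!
# `FluctuationComparisonRegPrIntLS1aOneStepContinuousDensity` — ONE UNCUT (0.4) STEP MAPS A BOUNDED CONTINUOUS DENSITY TO A LAW WITH A CONTINUOUS DENSITY ON ALL COARSE FIELDS
# (SU(2), FULL GUARD, NO SMALLNESS), MODULO THE TWO CHART-SIDE NULL TRACES (F4-c)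

Cell `ym3-torus` (HUMAN RULING D-0037: rung R3 = continuum SU(2) Yang–Mills on T³ — NOT d = 4, NOT infinite volume, NOT a mass gap, NOT Clay), WIDTH COPY «width 17»
of ym3-torus-p1, seat `ym3-torus-px17` gen 21; `--kind proof --supports stmt-QuantumFields-20520 --as helper` (count-neutral).  THEOREMS ONLY (no `def`, no `sorry`,
no `instance`, no `notation`, default heartbeats).  FILE (F6) of the seat's 12:58Z INTENT (S1aᴴ `RunClassMembershipH` conjunct (c) at the ANCHOR heights).

WHAT.  `j + 1 ≤ m + K`; `ρ ≥ 0` a bounded measurable CONTINUOUS density of fine fields (`GaugeField P j SU(2)`, w.r.t. `dU = fieldMeasure P j`).  THEN the push-forward of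
`ρ·dU` under the typed (0.4) averaging `avgFun ℰp` (`ℰp = expMeanLogSU`, guard `δ = deltaSU (Fin 2)`, identity fallback off the guard) has a density `g ≥ 0` w.r.t.
`dV = fieldMeasure P (j+1)` that is CONTINUOUS ON ALL coarse fields — PROVIDED the two chart-side null traces (F4-c) hold at every fine configuration (hypotheses `hNullE`,
`hNullI`, delivered by px20 g22 over ✓p824672 ∕ ✓`…S1aGuardSphereNull`; any additive Haar measure `η` on `𝔰𝔲(2)` with its Borel structure).

HOW (the local-face road on the FULL guard, UV3-NODE §77.9).  Split the fine space into the finitely many guard cells `C_s = {U | Small U c ↔ c ∈ s}` (`s : Finset` of coarse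
bonds); on `C_s` the typed averaging IS the cell map `cell_s` of ✓p824404 (`cellMap_eq_avgFun_of_cell`, `E` = the measurable extended average ✓`exists_extendedAverage`);
`r_s := ρ·1_{C_s}` vanishes off the CLOSED set `K_s = {∀ c ∈ s, ∀ i, dist1 (loopHol U c i) ≤ δ}` (every point of which has its `s`-families in the `1∕2`-guard, `δ ≤ 1∕3`)
and is continuous at every `U ∈ K_s` on no cell boundary; the primed lit glue ✓`Node00.RegSetOfLocalFaces.exists_continuous_density_SUN_of_flatLocalFaces'` with the faces
of (F5b) ✓`localFace_cellMap` (+ ✓`continuousAt_cellMap`) gives a continuous push-forward density `g_s` of `r_s·dU` under `cell_s`; summing over `s` (the preimages under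
`avgFun` and `cell_s` agree on `C_s`) gives `g = Σ_s g_s`.

CONTENT (namespace `Summit.QuantumFields.YangMills.Theorems.FluctuationComparisonRegPrIntLS1aOneStepContinuousDensity`).  §1 cells: `deltaSU_lt_half`, `small_iff_of_near`
(cell membership is locally constant off the boundary spheres), `isClosed_closedCell`, `measurableSet_cell`, `continuousAt_indicator_mul_of_offBoundary`; §2 ★★`exists_continuous_density_cellMap`
(one cell, via the glue); §3 ★★★`exists_continuous_density_map_avgFun_of_continuous` (the sum over cells).

HONEST FRAMING.  Measure-theoretic bookkeeping over (F5a)(F5b), ✓p824404, ✓p823765 and lit Node00; the (F4-c) traces are HYPOTHESES; nothing of Bałaban's analysis is asserted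
or proved; S1aᴴ (c) at the anchor heights NOT closed by this file ((F7): the induction `K → Ts` from the Gibbs density and the plug into `RunClassMembershipH` remain); (m), (a),
S1aᴴ, the five registered stubs, crux 20520 ∕ 19936 ∕ 19200 and `YM3TorusSU2` NOT proved; rung R3 = SU(2) YM₃ on T³ — NOT d = 4, NOT infinite volume, NOT a mass gap, NOT
Clay; the Yang–Mills mass gap is NOT proved.
References: [Balaban1987RG1] CMP 109 (1987) (0.4) p. 253, (0.13) p. 254, p. 259; [EvansGariepy1992] §3.4.3; [Helgason2000] Ch. I §1 Thm. 1.14.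
-/

set_option autoImplicit false

noncomputable section

open scoped Matrix.Norms.L2Operator Topology ENNReal Matrix
open Filter Set Function MeasureTheory

namespace Summit.QuantumFields.YangMills.Theorems.FluctuationComparisonRegPrIntLS1aOneStepContinuousDensity

open Literature.MathematicalPhysics.QuantumFieldTheory.Balaban1983to89
open Literature.MathematicalPhysics.QuantumFieldTheory.Balaban1983to89.HaarExponentialChart
open Literature.MathematicalPhysics.QuantumFieldTheory.Balaban1983to89.HaarExponentialChart.IsChartRep
open Literature.MathematicalPhysics.QuantumFieldTheory.Balaban1983to89.BlockAveraging (Small Idx avgFun loopHol corr)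
open Literature.MathematicalPhysics.QuantumFieldTheory.Balaban1983to89.BlockAveragingHaarAC (centralBond IsCentral openHol pre post centralBond_injective)
open Literature.MathematicalPhysics.QuantumFieldTheory.Balaban1983to89.BlockAveragingEMLHaarAC (fibreFamily)
open Literature.MathematicalPhysics.QuantumFieldTheory.Balaban1983to89.ExpMeanLog (expMeanLogSU deltaSU deltaSU_pos eml lt_third_of_lt_deltaSU)
open Literature.MathematicalPhysics.QuantumFieldTheory.Balaban1983to89.Node00 (SU)
open Literature.MathematicalPhysics.QuantumFieldTheory.Balaban1983to89.FieldMeasureExpChartChangeOfVariables (fieldMeasure_eq_pi)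
open Summit.QuantumFields.YangMills.Theorems.FluctuationComparisonRegPrIntLS1aGuardSphereNull (continuous_dist1_su)
open Summit.QuantumFields.YangMills.Theorems.FluctuationComparisonRegPrIntLS1aCellMapExtendedAverage
open Summit.QuantumFields.YangMills.Theorems.FluctuationComparisonRegPrIntLS1aCellMapLocalFace

variable {P : Params} {j : ℕ}

/-! ## §1 The guard cells `C_s`, their closed hulls `K_s`, and local constancy of cell membership off the boundary spheres -/

section Cells

/-- `δ_{SU(2)} < 1∕2` (indeed `≤ 1∕3`). [cite: Balaban1985Averaging, (19) p.21] -/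
theorem deltaSU_lt_half : deltaSU (Fin 2) < 1 / 2 := by
  have h : deltaSU (Fin 2) ≤ 1 / 3 := min_le_left _ _
  linarith

/-- `dist1 g = ‖↑g − 1‖`. [cite: Balaban1985Averaging, (19) p.21] -/
theorem dist1_eq_norm (g : SU 2) : dist1 g = ‖((g : SU 2) : Matrix (Fin 2) (Fin 2) ℂ) - 1‖ := rfl

/-- The loop distances `U ↦ dist1 (loopHol U c i)` are continuous. [cite: Balaban1985Averaging, (19) p.21] -/
theorem continuous_dist1_loopHol (c : PBond P (j + 1)) (i : Idx P) :
    Continuous fun U : GaugeField P j (SU 2) => dist1 (loopHol U c i) :=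
  continuous_dist1_su.comp (BlockAveraging.continuous_holAt _)

/-- ★ **CELL MEMBERSHIP IS LOCALLY CONSTANT OFF THE BOUNDARY SPHERES**: if no loop distance of `U` equals `δ`, then near `U` every `Small · c` has the same truth value as at `U`.
[cite: Balaban1987RG1, (0.4) p.253 (bookkeeping)] -/
theorem eventually_small_iff (U : GaugeField P j (SU 2)) (hQ : ∀ (c : PBond P (j + 1)) (i : Idx P), dist1 (loopHol U c i) ≠ deltaSU (Fin 2)) :
    ∀ᶠ U' in 𝓝 U, ∀ c : PBond P (j + 1), Small (expMeanLogSU (n := Fin 2)) U' c ↔ Small (expMeanLogSU (n := Fin 2)) U c := by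
  refine eventually_all.2 fun c => ?_
  by_cases hS : Small (expMeanLogSU (n := Fin 2)) U c
  · have h : ∀ᶠ U' in 𝓝 U, Small (expMeanLogSU (n := Fin 2)) U' c := by
      refine eventually_all.2 fun i => ?_
      exact (continuous_dist1_loopHol c i).continuousAt.eventually (isOpen_Iio.mem_nhds (hS i))
    exact h.mono fun U' hU' => ⟨fun _ => hS, fun _ => hU'⟩
  · have hS' : ∃ i, deltaSU (Fin 2) < dist1 (loopHol U c i) := by
      by_contra hcon
      push Not at hcon
      exact hS fun i => lt_of_le_of_ne (hcon i) (hQ c i)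
    obtain ⟨i, hi⟩ := hS'
    have h : ∀ᶠ U' in 𝓝 U, deltaSU (Fin 2) < dist1 (loopHol U' c i) :=
      (continuous_dist1_loopHol c i).continuousAt.eventually (isOpen_Ioi.mem_nhds hi)
    exact h.mono fun U' hU' => ⟨fun hS'' => absurd (hS'' i) (not_lt.2 hU'.le), fun h => absurd h hS⟩

/-- The closed hull `K_s = {∀ c ∈ s, ∀ i, dist1 (loopHol U c i) ≤ δ}` is closed. [cite: Balaban1987RG1, (0.4) p.253 (bookkeeping)] -/
theorem isClosed_closedCell (s : Finset (PBond P (j + 1))) :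
    IsClosed {U : GaugeField P j (SU 2) | ∀ c ∈ s, ∀ i : Idx P, dist1 (loopHol U c i) ≤ deltaSU (Fin 2)} := by
  have h : {U : GaugeField P j (SU 2) | ∀ c ∈ s, ∀ i : Idx P, dist1 (loopHol U c i) ≤ deltaSU (Fin 2)} =
      ⋂ c ∈ s, ⋂ i : Idx P, {U | dist1 (loopHol U c i) ≤ deltaSU (Fin 2)} := by
    ext U; simp only [Set.mem_setOf_eq, Set.mem_iInter]
  rw [h]
  exact isClosed_biInter fun c _ => isClosed_iInter fun i => isClosed_le (continuous_dist1_loopHol c i) continuous_const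

/-- On the closed hull the `s`-families lie in the `1∕2`-guard. [cite: Balaban1987RG1, (0.4) p.253 (bookkeeping)] -/
theorem halfGuard_of_mem_closedCell {s : Finset (PBond P (j + 1))} {U : GaugeField P j (SU 2)}
    (hU : U ∈ {U : GaugeField P j (SU 2) | ∀ c ∈ s, ∀ i : Idx P, dist1 (loopHol U c i) ≤ deltaSU (Fin 2)}) :
    ∀ c ∈ s, ∀ i, ‖((loopHol U c i : SU 2) : Matrix (Fin 2) (Fin 2) ℂ) - 1‖ < 1 / 2 :=
  fun c hc i => (dist1_eq_norm (loopHol U c i)) ▸ (hU c hc i).trans_lt deltaSU_lt_half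

/-- The guard cell `C_s` is measurable. [cite: Balaban1987RG1, (0.4) p.253 (bookkeeping)] -/
theorem measurableSet_cell (s : Finset (PBond P (j + 1))) :
    MeasurableSet {U : GaugeField P j (SU 2) | ∀ c : PBond P (j + 1), Small (expMeanLogSU (n := Fin 2)) U c ↔ c ∈ s} := by
  haveI := Literature.MathematicalPhysics.QuantumLattice.secondCountableTopology_su2
  haveI : OpensMeasurableSpace (GaugeField P j (SU 2)) := inferInstanceAs (OpensMeasurableSpace (PBond P j → SU 2))
  have hSm : ∀ c, MeasurableSet {U : GaugeField P j (SU 2) | Small (expMeanLogSU (n := Fin 2)) U c} := by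
    intro c
    have hopen : IsOpen {U : GaugeField P j (SU 2) | Small (expMeanLogSU (n := Fin 2)) U c} := by
      have : {U : GaugeField P j (SU 2) | Small (expMeanLogSU (n := Fin 2)) U c} = ⋂ i : Idx P, {U | dist1 (loopHol U c i) < deltaSU (Fin 2)} := by
        ext U; simp only [Set.mem_setOf_eq, Set.mem_iInter]; rfl
      rw [this]; exact isOpen_iInter_of_finite fun i => isOpen_lt (continuous_dist1_loopHol c i) continuous_const
    exact hopen.measurableSet
  have h : {U : GaugeField P j (SU 2) | ∀ c : PBond P (j + 1), Small (expMeanLogSU (n := Fin 2)) U c ↔ c ∈ s} =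
      ⋂ c : PBond P (j + 1), {U | Small (expMeanLogSU (n := Fin 2)) U c ↔ c ∈ s} := by
    ext U; simp only [Set.mem_setOf_eq, Set.mem_iInter]
  rw [h]
  refine MeasurableSet.iInter fun c => ?_
  by_cases hc : c ∈ s
  · have : {U : GaugeField P j (SU 2) | Small (expMeanLogSU (n := Fin 2)) U c ↔ c ∈ s} = {U | Small (expMeanLogSU (n := Fin 2)) U c} := by
      ext U; simp only [Set.mem_setOf_eq, hc, iff_true]
    rw [this]; exact hSm c
  · have : {U : GaugeField P j (SU 2) | Small (expMeanLogSU (n := Fin 2)) U c ↔ c ∈ s} = {U | Small (expMeanLogSU (n := Fin 2)) U c}ᶜ := by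
      ext U; simp only [Set.mem_setOf_eq, hc, iff_false, Set.mem_compl_iff]
    rw [this]; exact (hSm c).compl

/-- The cell indicator densities `ρ·1_{C_s}` sum to `ρ` (every configuration lies in exactly one cell, `s = {c | Small U c}`). [cite: Balaban1987RG1, (0.4) p.253 (bookkeeping)] -/
theorem sum_indicator_cell (ρ : GaugeField P j (SU 2) → ℝ) (U : GaugeField P j (SU 2)) :
    ∑ s : Finset (PBond P (j + 1)), ENNReal.ofReal ({U : GaugeField P j (SU 2) | ∀ c : PBond P (j + 1), Small (expMeanLogSU (n := Fin 2)) U c ↔ c ∈ s}.indicator ρ U) =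
      ENNReal.ofReal (ρ U) := by
  classical
  rw [Finset.sum_eq_single (Finset.univ.filter fun c => Small (expMeanLogSU (n := Fin 2)) U c)]
  · rw [Set.indicator_of_mem]
    intro c
    simp only [Finset.mem_filter, Finset.mem_univ, true_and]
  · intro s _ hs
    rw [Set.indicator_of_notMem, ENNReal.ofReal_zero]
    intro hU
    apply hs
    ext c
    simp only [Finset.mem_filter, Finset.mem_univ, true_and]
    exact (hU c).symm
  · intro h; exact absurd (Finset.mem_univ _) h

end Cells

/-! ## §2 One cell: the glue over the faces of (F5b) -/

section OneCell

variable [MeasurableSpace (specialUnitaryLogChart (Fin 2)).lie] [BorelSpace (specialUnitaryLogChart (Fin 2)).lie]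
  (η : Measure (specialUnitaryLogChart (Fin 2)).lie) [η.IsAddHaarMeasure]

/-- ★★ **ONE CELL**: for the cell map `cell_s` of a measurable extended average `E` (`= eml` on, continuous on the `1∕2`-guard), every bounded measurable `ρ ≥ 0` and the cell
indicator `1_{C_s}`, IF `ρ·1_{C_s}` is continuous at every configuration of the closed hull `K_s` on no cell boundary (e.g. `ρ` continuous), then `(ρ·1_{C_s})·dU` has under
`cell_s` a push-forward density CONTINUOUS on all coarse fields — lit glue ✓`exists_continuous_density_SUN_of_flatLocalFaces'` over (F5b) ✓`localFace_cellMap`, modulo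
the two (F4-c) null traces at every `U₀`. [cite: Balaban1987RG1, (0.4) p.253, (0.13) p.254; EvansGariepy1992, §3.4.3 Thm 2] -/
theorem exists_continuous_density_cellMap (hj : j + 1 ≤ P.m + P.K) (E : (Idx P → SU 2) → SU 2) (hEm : Measurable E)
    (hEeml : ∀ W, (∀ i, ‖((W i : SU 2) : Matrix (Fin 2) (Fin 2) ℂ) - 1‖ < 1 / 2) →
      ((E W : SU 2) : Matrix (Fin 2) (Fin 2) ℂ) = eml fun i => ((W i : SU 2) : Matrix (Fin 2) (Fin 2) ℂ))
    (hEc : ContinuousOn E {W | ∀ i, ‖((W i : SU 2) : Matrix (Fin 2) (Fin 2) ℂ) - 1‖ < 1 / 2}) (s : Finset (PBond P (j + 1)))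
    (hNullE : ∀ (U₀ : GaugeField P j (SU 2)), ∀ c ∈ s, ∀ v : SU 2,
      Measure.pi (fun _ : {b : PBond P j // ∀ c' : PBond P (j + 1), b ≠ centralBond c'} => η)
      {k | (∀ b, k b ∈ Metric.ball (0 : (specialUnitaryLogChart (Fin 2)).lie) (chartRadius (specialUnitaryLogChart (Fin 2)))) ∧
        ∃ W : SU 2,
          (∀ i, dist1 (fibreFamily (fun b : PBond P j => (isChartRep_specialUnitaryGroup (n := Fin 2)).expChart (Function.extend Subtype.val k 0 b) * U₀ b) c W i) < 1 / 2) ∧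
          (∃ i, dist1 (fibreFamily (fun b : PBond P j => (isChartRep_specialUnitaryGroup (n := Fin 2)).expChart (Function.extend Subtype.val k 0 b) * U₀ b) c W i) =
            deltaSU (Fin 2)) ∧
          E (fibreFamily (fun b : PBond P j => (isChartRep_specialUnitaryGroup (n := Fin 2)).expChart (Function.extend Subtype.val k 0 b) * U₀ b) c W) * W = v} = 0)
    (hNullI : ∀ (U₀ : GaugeField P j (SU 2)), ∀ c, c ∉ s → ∀ v : SU 2,
      Measure.pi (fun _ : {b : PBond P j // ∀ c' : PBond P (j + 1), b ≠ centralBond c'} => η)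
      {k | (∀ b, k b ∈ Metric.ball (0 : (specialUnitaryLogChart (Fin 2)).lie) (chartRadius (specialUnitaryLogChart (Fin 2)))) ∧
        ∃ i, dist1 (fibreFamily (fun b : PBond P j => (isChartRep_specialUnitaryGroup (n := Fin 2)).expChart (Function.extend Subtype.val k 0 b) * U₀ b) c v i) =
          deltaSU (Fin 2)} = 0)
    (r : GaugeField P j (SU 2) → ℝ) (hrm : Measurable r) (hr0 : ∀ U, 0 ≤ r U) (hrC : ∃ C₀ : ℝ, ∀ U, r U ≤ C₀)
    (hrK : ∀ U, U ∉ {U : GaugeField P j (SU 2) | ∀ c ∈ s, ∀ i : Idx P, dist1 (loopHol U c i) ≤ deltaSU (Fin 2)} → r U = 0)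
    (hrc : ∀ U ∈ {U : GaugeField P j (SU 2) | ∀ c ∈ s, ∀ i : Idx P, dist1 (loopHol U c i) ≤ deltaSU (Fin 2)},
      (∀ (c : PBond P (j + 1)) (i : Idx P), dist1 (loopHol U c i) ≠ deltaSU (Fin 2)) → ContinuousAt r U) :
    ∃ g : GaugeField P (j + 1) (SU 2) → ℝ, Continuous g ∧ (∀ V, 0 ≤ g V) ∧
      ∀ S' : Set (GaugeField P (j + 1) (SU 2)), MeasurableSet S' →
        ((fieldMeasure P j (SU 2)).withDensity fun U => ENNReal.ofReal (r U))
            ((fun (U : GaugeField P j (SU 2)) (c : PBond P (j + 1)) => (if c ∈ s then E (loopHol U c) else 1) * AveragingRT.axialAvg U c) ⁻¹' S') =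
          ∫⁻ V in S', ENNReal.ofReal (g V) ∂(fieldMeasure P (j + 1) (SU 2)) := by
  obtain ⟨g, hgc, hg0, hgS, -⟩ := Node00.RegSetOfLocalFaces.exists_continuous_density_SUN_of_flatLocalFaces' (N := 2) η
    (M := fun (U : GaugeField P j (SU 2)) (c : PBond P (j + 1)) => (if c ∈ s then E (loopHol U c) else 1) * AveragingRT.axialAvg U c)
    (measurable_cellMap E s hEm) (fun U => ∀ (c : PBond P (j + 1)) (i : Idx P), dist1 (loopHol U c i) ≠ deltaSU (Fin 2))
    (isClosed_closedCell (P := P) (j := j) s) (fun U₀ hU₀ => ⟨continuousAt_cellMap E s hEc (halfGuard_of_mem_closedCell hU₀),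
      localFace_cellMap E s U₀ η hj hEm hEeml hEc (halfGuard_of_mem_closedCell hU₀) (hNullE U₀) (hNullI U₀)⟩)
    r hrm hr0 hrc hrC hrK
  exact ⟨g, hgc, hg0, fun S' hS' => by rw [fieldMeasure_eq_pi, fieldMeasure_eq_pi]; exact hgS S' hS'⟩

end OneCell

/-! ## §3 The sum over the guard cells: one uncut (0.4) step preserves «bounded continuous density» -/

section Sum

variable [MeasurableSpace (specialUnitaryLogChart (Fin 2)).lie] [BorelSpace (specialUnitaryLogChart (Fin 2)).lie]
  (η : Measure (specialUnitaryLogChart (Fin 2)).lie) [η.IsAddHaarMeasure]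

/-- ★★★ **ONE UNCUT (0.4) STEP MAPS A BOUNDED CONTINUOUS DENSITY TO A LAW WITH A DENSITY CONTINUOUS ON ALL COARSE FIELDS (SU(2), full guard, no smallness), MODULO
THE TWO CHART-SIDE NULL TRACES (F4-c).**  `ρ ≥ 0` bounded measurable continuous on `GaugeField P j SU(2)`; `hNullE ∕ hNullI` the (F4-c) traces at every `U₀` (any
additive Haar `η` on `𝔰𝔲(2)`).  THEN `(avgFun ℰp)_*(ρ·dU) = g·dV` with `g ≥ 0` CONTINUOUS everywhere (cells + ✓`exists_continuous_density_cellMap` + sum).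
[cite: Balaban1987RG1, (0.4) p.253, (0.13) p.254, p.259; EvansGariepy1992, §3.4.3 Thm 2] -/
theorem exists_continuous_density_map_avgFun_of_continuous (hj : j + 1 ≤ P.m + P.K)
    (hNullE : ∀ (E : (Idx P → SU 2) → SU 2), (∀ W, (∀ i, ‖((W i : SU 2) : Matrix (Fin 2) (Fin 2) ℂ) - 1‖ < 1 / 2) →
        ((E W : SU 2) : Matrix (Fin 2) (Fin 2) ℂ) = eml fun i => ((W i : SU 2) : Matrix (Fin 2) (Fin 2) ℂ)) →
      ∀ (U₀ : GaugeField P j (SU 2)) (c : PBond P (j + 1)) (v : SU 2),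
      Measure.pi (fun _ : {b : PBond P j // ∀ c' : PBond P (j + 1), b ≠ centralBond c'} => η)
      {k | (∀ b, k b ∈ Metric.ball (0 : (specialUnitaryLogChart (Fin 2)).lie) (chartRadius (specialUnitaryLogChart (Fin 2)))) ∧
        ∃ W : SU 2,
          (∀ i, dist1 (fibreFamily (fun b : PBond P j => (isChartRep_specialUnitaryGroup (n := Fin 2)).expChart (Function.extend Subtype.val k 0 b) * U₀ b) c W i) < 1 / 2) ∧
          (∃ i, dist1 (fibreFamily (fun b : PBond P j => (isChartRep_specialUnitaryGroup (n := Fin 2)).expChart (Function.extend Subtype.val k 0 b) * U₀ b) c W i) =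
            deltaSU (Fin 2)) ∧
          E (fibreFamily (fun b : PBond P j => (isChartRep_specialUnitaryGroup (n := Fin 2)).expChart (Function.extend Subtype.val k 0 b) * U₀ b) c W) * W = v} = 0)
    (hNullI : ∀ (U₀ : GaugeField P j (SU 2)) (c : PBond P (j + 1)) (v : SU 2),
      Measure.pi (fun _ : {b : PBond P j // ∀ c' : PBond P (j + 1), b ≠ centralBond c'} => η)
      {k | (∀ b, k b ∈ Metric.ball (0 : (specialUnitaryLogChart (Fin 2)).lie) (chartRadius (specialUnitaryLogChart (Fin 2)))) ∧
        ∃ i, dist1 (fibreFamily (fun b : PBond P j => (isChartRep_specialUnitaryGroup (n := Fin 2)).expChart (Function.extend Subtype.val k 0 b) * U₀ b) c v i) =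
          deltaSU (Fin 2)} = 0)
    (ρ : GaugeField P j (SU 2) → ℝ) (hρm : Measurable ρ) (hρ0 : ∀ U, 0 ≤ ρ U) (hρC : ∃ C₀ : ℝ, ∀ U, ρ U ≤ C₀) (hρc : Continuous ρ) :
    ∃ g : GaugeField P (j + 1) (SU 2) → ℝ, Continuous g ∧ (∀ V, 0 ≤ g V) ∧
      ∀ S' : Set (GaugeField P (j + 1) (SU 2)), MeasurableSet S' →
        ((fieldMeasure P j (SU 2)).withDensity fun U => ENNReal.ofReal (ρ U)) (avgFun (expMeanLogSU (n := Fin 2)) ⁻¹' S') =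
          ∫⁻ V in S', ENNReal.ofReal (g V) ∂(fieldMeasure P (j + 1) (SU 2)) := by
  classical
  haveI := Literature.MathematicalPhysics.QuantumLattice.secondCountableTopology_su2
  haveI : BorelSpace (GaugeField P (j + 1) (SU 2)) := inferInstanceAs (BorelSpace (PBond P (j + 1) → SU 2))
  haveI : BorelSpace (GaugeField P j (SU 2)) := inferInstanceAs (BorelSpace (PBond P j → SU 2))
  obtain ⟨E, hEm, hEeml, hEavg, hEc⟩ := exists_extendedAverage (ι := Idx P)
  obtain ⟨C₀, hC₀⟩ := hρC
  -- the cell densities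
  have hcell : ∀ s : Finset (PBond P (j + 1)), ∃ g : GaugeField P (j + 1) (SU 2) → ℝ, Continuous g ∧ (∀ V, 0 ≤ g V) ∧
      ∀ S' : Set (GaugeField P (j + 1) (SU 2)), MeasurableSet S' →
        ((fieldMeasure P j (SU 2)).withDensity fun U =>
            ENNReal.ofReal ({U : GaugeField P j (SU 2) | ∀ c : PBond P (j + 1), Small (expMeanLogSU (n := Fin 2)) U c ↔ c ∈ s}.indicator ρ U))
            ((fun (U : GaugeField P j (SU 2)) (c : PBond P (j + 1)) => (if c ∈ s then E (loopHol U c) else 1) * AveragingRT.axialAvg U c) ⁻¹' S') =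
          ∫⁻ V in S', ENNReal.ofReal (g V) ∂(fieldMeasure P (j + 1) (SU 2)) := by
    intro s
    refine exists_continuous_density_cellMap η hj E hEm hEeml hEc s (fun U₀ c _ v => hNullE E hEeml U₀ c v) (fun U₀ c _ v => hNullI U₀ c v)
      _ (hρm.indicator (measurableSet_cell (P := P) (j := j) s)) (fun U => Set.indicator_nonneg (fun U _ => hρ0 U) U)
      ⟨max C₀ 0, fun U => ?_⟩ (fun U hU => ?_) (fun U hU hQ => ?_)
    · by_cases hU : U ∈ {U : GaugeField P j (SU 2) | ∀ c : PBond P (j + 1), Small (expMeanLogSU (n := Fin 2)) U c ↔ c ∈ s}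
      · rw [Set.indicator_of_mem hU]; exact (hC₀ U).trans (le_max_left _ _)
      · rw [Set.indicator_of_notMem hU]; exact le_max_right _ _
    · refine Set.indicator_of_notMem (fun hU' => hU fun c hc i => ?_) _
      exact ((hU' c).2 hc i).le
    · -- continuity off the boundary spheres: cell membership is locally constant
      have hev := eventually_small_iff (P := P) (j := j) U hQ
      by_cases hUC : U ∈ {U : GaugeField P j (SU 2) | ∀ c : PBond P (j + 1), Small (expMeanLogSU (n := Fin 2)) U c ↔ c ∈ s}
      · refine (hρc.continuousAt.congr ?_)
        filter_upwards [hev] with U' hU'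
        rw [Set.indicator_of_mem]
        exact fun c => (hU' c).trans (hUC c)
      · refine (continuousAt_const (y := (0 : ℝ))).congr ?_
        filter_upwards [hev] with U' hU'
        rw [Set.indicator_of_notMem]
        exact fun h => hUC fun c => (hU' c).symm.trans (h c)
  choose g hgc hg0 hgS using hcell
  refine ⟨fun V => ∑ s : Finset (PBond P (j + 1)), g s V, continuous_finsetSum _ fun s _ => hgc s, fun V => Finset.sum_nonneg fun s _ => hg0 s V,
    fun S' hS' => ?_⟩
  have havgm : Measurable (avgFun (expMeanLogSU (n := Fin 2)) : GaugeField P j (SU 2) → GaugeField P (j + 1) (SU 2)) :=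
    BlockAveraging.measurable_avgFun _ ExpMeanLog.measurable_expMeanLogSU_E
  have hTm : MeasurableSet (avgFun (expMeanLogSU (n := Fin 2)) ⁻¹' S' : Set (GaugeField P j (SU 2))) := havgm hS'
  have hTm' : ∀ s : Finset (PBond P (j + 1)), MeasurableSet ((fun (U : GaugeField P j (SU 2)) (c : PBond P (j + 1)) =>
      (if c ∈ s then E (loopHol U c) else 1) * AveragingRT.axialAvg U c) ⁻¹' S') := fun s => measurable_cellMap E s hEm hS'
  rw [withDensity_apply _ hTm]
  -- split the fine integral over the cells
  have hsplit : ∫⁻ U in avgFun (expMeanLogSU (n := Fin 2)) ⁻¹' S', ENNReal.ofReal (ρ U) ∂(fieldMeasure P j (SU 2)) =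
      ∑ s : Finset (PBond P (j + 1)), ∫⁻ U in avgFun (expMeanLogSU (n := Fin 2)) ⁻¹' S',
        ENNReal.ofReal ({U : GaugeField P j (SU 2) | ∀ c : PBond P (j + 1), Small (expMeanLogSU (n := Fin 2)) U c ↔ c ∈ s}.indicator ρ U)
          ∂(fieldMeasure P j (SU 2)) := by
    rw [← lintegral_finsetSum _ fun s _ => (hρm.indicator (measurableSet_cell (P := P) (j := j) s)).ennreal_ofReal]
    exact lintegral_congr fun U => (sum_indicator_cell (P := P) (j := j) ρ U).symm
  rw [hsplit]
  -- each cell: the preimages under `avgFun` and `cell_s` agree on the support of `ρ·1_{C_s}`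
  have hterm : ∀ s : Finset (PBond P (j + 1)), ∫⁻ U in avgFun (expMeanLogSU (n := Fin 2)) ⁻¹' S',
        ENNReal.ofReal ({U : GaugeField P j (SU 2) | ∀ c : PBond P (j + 1), Small (expMeanLogSU (n := Fin 2)) U c ↔ c ∈ s}.indicator ρ U)
          ∂(fieldMeasure P j (SU 2)) =
      ∫⁻ V in S', ENNReal.ofReal (g s V) ∂(fieldMeasure P (j + 1) (SU 2)) := by
    intro s
    rw [← hgS s S' hS', withDensity_apply _ (hTm' s), ← lintegral_indicator hTm, ← lintegral_indicator (hTm' s)]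
    refine lintegral_congr fun U => ?_
    by_cases hU : U ∈ {U : GaugeField P j (SU 2) | ∀ c : PBond P (j + 1), Small (expMeanLogSU (n := Fin 2)) U c ↔ c ∈ s}
    · have heq : (fun c => (if c ∈ s then E (loopHol U c) else 1) * AveragingRT.axialAvg U c) = avgFun (expMeanLogSU (n := Fin 2)) U :=
        cellMap_eq_avgFun_of_cell E s hEavg hU
      have hmem : U ∈ (avgFun (expMeanLogSU (n := Fin 2)) ⁻¹' S' : Set (GaugeField P j (SU 2))) ↔
          U ∈ ((fun (U : GaugeField P j (SU 2)) (c : PBond P (j + 1)) => (if c ∈ s then E (loopHol U c) else 1) * AveragingRT.axialAvg U c) ⁻¹' S') := by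
        change avgFun (expMeanLogSU (n := Fin 2)) U ∈ S' ↔ (fun (c : PBond P (j + 1)) => (if c ∈ s then E (loopHol U c) else 1) * AveragingRT.axialAvg U c) ∈ S'
        rw [heq]
        exact Iff.rfl
      by_cases hT : U ∈ (avgFun (expMeanLogSU (n := Fin 2)) ⁻¹' S' : Set (GaugeField P j (SU 2)))
      · rw [Set.indicator_of_mem hT, Set.indicator_of_mem (hmem.1 hT)]
      · rw [Set.indicator_of_notMem hT, Set.indicator_of_notMem (fun h => hT (hmem.2 h))]
    · have h0 : ENNReal.ofReal ({U : GaugeField P j (SU 2) | ∀ c : PBond P (j + 1), Small (expMeanLogSU (n := Fin 2)) U c ↔ c ∈ s}.indicator ρ U) = 0 := by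
        rw [Set.indicator_of_notMem hU, ENNReal.ofReal_zero]
      have hz : ∀ T : Set (GaugeField P j (SU 2)),
          T.indicator (fun U => ENNReal.ofReal ({U : GaugeField P j (SU 2) | ∀ c : PBond P (j + 1), Small (expMeanLogSU (n := Fin 2)) U c ↔ c ∈ s}.indicator ρ U)) U = 0 := by
        intro T
        by_cases hT : U ∈ T
        · rw [Set.indicator_of_mem hT, h0]
        · exact Set.indicator_of_notMem hT _
      rw [hz, hz]
  simp_rw [hterm]
  rw [← lintegral_finsetSum _ fun s _ => (hgc s).measurable.ennreal_ofReal]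
  refine setLIntegral_congr_fun hS' (fun V _ => ?_)
  exact (ENNReal.ofReal_sum_of_nonneg fun s _ => hg0 s V).symm

end Sum



end Summit.QuantumFields.YangMills.Theorems.FluctuationComparisonRegPrIntLS1aOneStepContinuousDensity

end
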